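import Summits.BirchSwinnertonDyer.BirchSwinnertonDyer.Theorems.QuadraticBranchSignedControlEtaLayerKummer
import Summits.BirchSwinnertonDyer.Rank1Residual.Additive.ZpTowerSelmerInfty
import HarnessLib

/-!
# Base change of local Selmer conditions along `subgroupH1Iso`, file 4: LOCAL PACKAGES at the places
# of `K` and of `L`
(cell `bsd-potss`, seat `bsd-potss-k8q-c3` g2; rung K8, route `QuadraticBranchSignedControl`, crux
`EtaTransportSigned` (stmt-BirchSwinnertonDyer-19115), child `EtaLayerComparison`
(stmt-BirchSwinnertonDyer-19583))

WHAT. Files 1–3 transport every local Selmer condition (classical and Kummer/signed) BOTH ways along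
a local package `(ι, ι₂, ι', f)` with the compatibilities `ι' ∘ ι_L = ι₂ ∘ ι`, `ι₂|_E = f` and
the fixing hypothesis for `galRange L`. This file PRODUCES the packages (file 5 assembles the
classical Selmer groups, file 6 the signed ones):
* §1 generic producers: `forall_fix_of_closure_eq_top` (the fixing hypothesis from `E' = f(E)·L`,
  T-res step (4)), `exists_ringEquiv_algebraicClosure` (`ι₂` over `E'` from an `E'`-structure on `Ē`),
  `exists_package_of_factorisation` (from `ι` and a factorisation of `ι|_L` through `E'`) and
  `exists_package_of_embedding` (from an `L`-embedding `ι'₀ : L̄ → Ē'`, `ι := ι₂⁻¹ ∘ ι'₀ ∘ ι_L`);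
* §2 finite places: for a model `e : K_v ≃ E` of the completion (`E = K_v`, or `ℚ_p` via
  `padicEquiv`), every `K`-embedding `K̄ → Ē` has a package at some `w ∣ v`
  (`exists_place_factorisation`), and every `L`-embedding `L̄ → L̄_w`, `w ∣ v`, has one;
  §3 the same at the infinite places.

HONEST FRAMING (cell `bsd-potss`, run/shared/lean/pub/bsd-potss/; FULL-BSD rank ≤ 1 programme):
INFRASTRUCTURE THEOREMS ONLY — no definition, no named Literature fact, no `sorry`, axioms
standard; nothing about (C1_η), Kobayashi's theorems or `BSD(W, p)` is claimed; no label or count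
moves. Helper toward item 19583.

References: [SerreGaloisCohomology1997] II.§1.1; [NeukirchANT1999] II.§8 (`L ⊗_K K_v = ∏ L_w`);
[GreenbergLNM1716] §2; [Mazur1972] §6.
-/

set_option autoImplicit false
set_option linter.dupNamespace false

noncomputable section

open scoped Classical

open NumberField IsDedekindDomain
open Literature.NumberTheory.EllipticCurves
open Summit.BirchSwinnertonDyer.Rank1Residual.Additive
open Summit.BirchSwinnertonDyer.Rank1Residual.Additive.LocalTransport
open Summit.BirchSwinnertonDyer.Rank1Residual.Additive.BaseChange

universe u

namespace Summit.BirchSwinnertonDyer.BirchSwinnertonDyer.Theorems.EtaLayer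

/-! ## §1 Generic package producers -/

section Generic

variable {K : Type u} [Field K] (L : Type u) [Field L] [Algebra K L] [Algebra.IsAlgebraic K L]
variable {E : Type u} [Field E] [Algebra K E] {E' : Type u} [Field E'] [Algebra L E']
  [Algebra K E'] [IsScalarTower K L E']

omit [Algebra K E'] [IsScalarTower K L E'] in
/-- **The fixing hypothesis from generation** (T-res step (4)): if `E'` is generated as a ring by
`f(E)` and `L`, `ε : E' → Ē` restricts to `E → Ē` on `f(E)` and to `ι ∘ ι_L⁻¹` on `L`, and
`ι₂⁻¹|_{E'} = ε`, then every `h ∈ Γ_E` restricting into `galRange L` fixes `ι₂⁻¹(E')` pointwise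
(`h ∘ ε = ε` on generators: `h` fixes `E`, and `res_ι h = resGal L σ'` fixes `ι_L⁻¹(L)`).
[cite: SerreGaloisCohomology1997, II.§1.1] [cite: NeukirchANT1999, II.§8] -/
theorem forall_fix_of_closure_eq_top (ι : AlgebraicClosure K →ₐ[K] AlgebraicClosure E)
    (ι₂ : AlgebraicClosure E ≃+* AlgebraicClosure E') (f : E →+* E')
    (ε : E' →+* AlgebraicClosure E) (hεf : ε.comp f = algebraMap E (AlgebraicClosure E))
    (hεL : ∀ l : L, ε (algebraMap L E' l) =
      ι ((algEquivOfEmb L (closureEmb (K := K) L)).symm (algebraMap L (AlgebraicClosure L) l)))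
    (hι₂symm : ∀ y : E', ι₂.symm (algebraMap E' (AlgebraicClosure E') y) = ε y)
    (hgen : Subring.closure (Set.range f ∪ Set.range (algebraMap L E')) = ⊤)
    (h : Field.absoluteGaloisGroup E) (hh : resGalOfEmb ι h ∈ galRange (K := K) L) (y : E') :
    (show AlgebraicClosure E ≃ₐ[E] AlgebraicClosure E from h)
        (ι₂.symm (algebraMap E' (AlgebraicClosure E') y)) =
      ι₂.symm (algebraMap E' (AlgebraicClosure E') y) := by
  let ιL : AlgebraicClosure K ≃ₐ[K] AlgebraicClosure L := algEquivOfEmb L (closureEmb (K := K) L)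
  obtain ⟨σ', hσ'⟩ := hh
  rw [hι₂symm]
  have hσ : resGal (K := K) L σ' = resGalOfEmb ι h := hσ'
  have key : (((show AlgebraicClosure E ≃ₐ[E] AlgebraicClosure E from h) :
      AlgebraicClosure E →+* AlgebraicClosure E).comp ε) = ε := by
    refine RingHom.eq_of_eqOn_set_dense hgen ?_
    rintro _ (⟨a, rfl⟩ | ⟨l, rfl⟩)
    · have hfa : ε (f a) = algebraMap E (AlgebraicClosure E) a := RingHom.congr_fun hεf a
      change (show AlgebraicClosure E ≃ₐ[E] AlgebraicClosure E from h) (ε (f a)) = ε (f a)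
      rw [hfa]
      exact AlgEquiv.commutes _ a
    · have hz : (show AlgebraicClosure K ≃ₐ[K] AlgebraicClosure K from resGalOfEmb ι h)
          (ιL.symm (algebraMap L (AlgebraicClosure L) l)) =
          ιL.symm (algebraMap L (AlgebraicClosure L) l) := by
        apply ιL.injective
        rw [← hσ]
        have e := algEquivOfEmb_resGal_apply L σ' (ιL.symm (algebraMap L (AlgebraicClosure L) l))
        refine e.trans ?_
        change (show AlgebraicClosure L ≃ₐ[L] AlgebraicClosure L from σ') (ιL (ιL.symm _)) =
          ιL (ιL.symm _)
        rw [AlgEquiv.apply_symm_apply, AlgEquiv.commutes]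
      change (show AlgebraicClosure E ≃ₐ[E] AlgebraicClosure E from h) (ε (algebraMap L E' l)) =
        ε (algebraMap L E' l)
      rw [hεL l]
      exact (apply_resGalAuxOfEmb_apply ι h _).symm.trans (congrArg ι hz)
  exact RingHom.congr_fun key y

/-- **`Ē ≃ Ē'` over `E'`**: if `Ē` is an `E'`-algebra through `ε : E' → Ē` extending `E → Ē` along
`f : E → E'` (so `Ē/E'` is algebraic), there is a ring isomorphism `ι₂ : Ē ≃ Ē'` with
`ι₂ ∘ ε = (E' → Ē')` (T-res steps (1)–(2): `IsAlgClosed.lift` is bijective between algebraic closures).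
[cite: SerreGaloisCohomology1997, II.§1.1] -/
theorem exists_ringEquiv_algebraicClosure (f : E →+* E') (ε : E' →+* AlgebraicClosure E)
    (hεf : ε.comp f = algebraMap E (AlgebraicClosure E)) :
    ∃ ι₂ : AlgebraicClosure E ≃+* AlgebraicClosure E',
      ∀ y : E', ι₂ (ε y) = algebraMap E' (AlgebraicClosure E') y := by
  letI : Algebra E' (AlgebraicClosure E) := ε.toAlgebra
  letI : Algebra E E' := f.toAlgebra
  haveI : IsScalarTower E E' (AlgebraicClosure E) :=
    IsScalarTower.of_algebraMap_eq fun a ↦ (RingHom.congr_fun hεf a).symm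
  haveI : Algebra.IsAlgebraic E' (AlgebraicClosure E) := Algebra.IsAlgebraic.tower_top (K := E) E'
  let ι₂₀ : AlgebraicClosure E →ₐ[E'] AlgebraicClosure E' := IsAlgClosed.lift
  have hι₂bij : Function.Bijective ι₂₀ := by
    letI : Algebra (AlgebraicClosure E) (AlgebraicClosure E') := ι₂₀.toRingHom.toAlgebra
    haveI : IsScalarTower E' (AlgebraicClosure E) (AlgebraicClosure E') :=
      IsScalarTower.of_algebraMap_eq fun y ↦ (ι₂₀.commutes y).symm
    haveI : Algebra.IsAlgebraic (AlgebraicClosure E) (AlgebraicClosure E') :=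
      Algebra.IsAlgebraic.tower_top (K := E') (AlgebraicClosure E)
    exact IsAlgClosed.algebraMap_bijective_of_isIntegral
      (k := AlgebraicClosure E) (K := AlgebraicClosure E')
  exact ⟨RingEquiv.ofBijective ι₂₀.toRingHom hι₂bij, fun y ↦ ι₂₀.commutes y⟩

omit [Algebra K E'] [IsScalarTower K L E'] in
/-- **Package from a factorisation of `ι|_L` through `E'`** (T-res generic step, repackaged): given
a `K`-embedding `ι : K̄ → Ē`, `f : E → E'`, `ε : E' → Ē` with `ε ∘ f = (E → Ē)`,
`ε|_L = ι ∘ ι_L⁻¹|_L` and `E' = f(E)·L`, there are `ι₂ : Ē ≃ Ē'` and an `L`-embedding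
`ι' : L̄ → Ē'` with `ι' ∘ ι_L = ι₂ ∘ ι`, `ι₂|_E = f`, and the fixing hypothesis for `galRange L`.
[cite: SerreGaloisCohomology1997, II.§1.1] [cite: NeukirchANT1999, II.§8] -/
theorem exists_package_of_factorisation (ι : AlgebraicClosure K →ₐ[K] AlgebraicClosure E)
    (f : E →+* E') (ε : E' →+* AlgebraicClosure E)
    (hεf : ε.comp f = algebraMap E (AlgebraicClosure E))
    (hεL : ∀ l : L, ε (algebraMap L E' l) =
      ι ((algEquivOfEmb L (closureEmb (K := K) L)).symm (algebraMap L (AlgebraicClosure L) l)))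
    (hgen : Subring.closure (Set.range f ∪ Set.range (algebraMap L E')) = ⊤) :
    ∃ (ι₂ : AlgebraicClosure E ≃+* AlgebraicClosure E')
      (ι' : AlgebraicClosure L →ₐ[L] AlgebraicClosure E'),
      (∀ z : AlgebraicClosure K, ι' (closureEmb (K := K) L z) = ι₂ (ι z)) ∧
      (∀ y : E, ι₂ (algebraMap E (AlgebraicClosure E) y) =
        algebraMap E' (AlgebraicClosure E') (f y)) ∧
      (∀ h : Field.absoluteGaloisGroup E, resGalOfEmb ι h ∈ galRange (K := K) L → ∀ y : E',
        (show AlgebraicClosure E ≃ₐ[E] AlgebraicClosure E from h)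
            (ι₂.symm (algebraMap E' (AlgebraicClosure E') y)) =
          ι₂.symm (algebraMap E' (AlgebraicClosure E') y)) := by
  let ιL : AlgebraicClosure K ≃ₐ[K] AlgebraicClosure L := algEquivOfEmb L (closureEmb (K := K) L)
  obtain ⟨ι₂, hι₂ε⟩ := exists_ringEquiv_algebraicClosure f ε hεf
  have hι₂symm : ∀ y : E', ι₂.symm (algebraMap E' (AlgebraicClosure E') y) = ε y := fun y ↦ by
    rw [← hι₂ε, RingEquiv.symm_apply_apply]
  have hι'L : ∀ l : L,
      ι₂ (ι (ιL.symm (algebraMap L (AlgebraicClosure L) l))) =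
        algebraMap L (AlgebraicClosure E') l := fun l ↦ by
    rw [← hεL l, hι₂ε, ← IsScalarTower.algebraMap_apply]
  let ι' : AlgebraicClosure L →ₐ[L] AlgebraicClosure E' :=
    { ι₂.toRingHom.comp (ι.toRingHom.comp (ιL.symm : AlgebraicClosure L →+* AlgebraicClosure K)) with
      commutes' := fun l ↦ hι'L l }
  have hι'apply : ∀ z', ι' z' = ι₂ (ι (ιL.symm z')) := fun _ ↦ rfl
  refine ⟨ι₂, ι', fun z ↦ ?_, fun y ↦ ?_,
    forall_fix_of_closure_eq_top L ι ι₂ f ε hεf hεL hι₂symm hgen⟩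
  · rw [hι'apply, ← algEquivOfEmb_apply L (closureEmb (K := K) L) z, AlgEquiv.symm_apply_apply]
  · rw [← hι₂ε, ← RingHom.comp_apply, hεf]

/-- **Package from an `L`-embedding `ι'₀ : L̄ → Ē'`**: given `f : E → E'` over `K`,
`ε : E' → Ē` with `ε ∘ f = (E → Ē)` and `E' = f(E)·L`, there are `ι₂ : Ē ≃ Ē'` and a
`K`-embedding `ι : K̄ → Ē` (namely `ι₂⁻¹ ∘ ι'₀ ∘ ι_L`) with `ι'₀ ∘ ι_L = ι₂ ∘ ι`, `ι₂|_E = f`,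
and the fixing hypothesis. [cite: SerreGaloisCohomology1997, II.§1.1] [cite: NeukirchANT1999, II.§8] -/
theorem exists_package_of_embedding (ι'₀ : AlgebraicClosure L →ₐ[L] AlgebraicClosure E')
    (f : E →+* E') (hfK : ∀ x : K, f (algebraMap K E x) = algebraMap K E' x)
    (ε : E' →+* AlgebraicClosure E) (hεf : ε.comp f = algebraMap E (AlgebraicClosure E))
    (hgen : Subring.closure (Set.range f ∪ Set.range (algebraMap L E')) = ⊤) :
    ∃ (ι : AlgebraicClosure K →ₐ[K] AlgebraicClosure E) (ι₂ : AlgebraicClosure E ≃+* AlgebraicClosure E'),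
      (∀ z : AlgebraicClosure K, ι'₀ (closureEmb (K := K) L z) = ι₂ (ι z)) ∧
      (∀ y : E, ι₂ (algebraMap E (AlgebraicClosure E) y) =
        algebraMap E' (AlgebraicClosure E') (f y)) ∧
      (∀ h : Field.absoluteGaloisGroup E, resGalOfEmb ι h ∈ galRange (K := K) L → ∀ y : E',
        (show AlgebraicClosure E ≃ₐ[E] AlgebraicClosure E from h)
            (ι₂.symm (algebraMap E' (AlgebraicClosure E') y)) =
          ι₂.symm (algebraMap E' (AlgebraicClosure E') y)) := by
  let ιL : AlgebraicClosure K ≃ₐ[K] AlgebraicClosure L := algEquivOfEmb L (closureEmb (K := K) L)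
  obtain ⟨ι₂, hι₂ε⟩ := exists_ringEquiv_algebraicClosure f ε hεf
  have hι₂symm : ∀ y : E', ι₂.symm (algebraMap E' (AlgebraicClosure E') y) = ε y := fun y ↦ by
    rw [← hι₂ε, RingEquiv.symm_apply_apply]
  have hf' : ∀ y : E, ι₂ (algebraMap E (AlgebraicClosure E) y) =
      algebraMap E' (AlgebraicClosure E') (f y) := fun y ↦ by
    rw [← hι₂ε, ← RingHom.comp_apply, hεf]
  -- `ι := ι₂⁻¹ ∘ ι'₀ ∘ ι_L`, a `K`-algebra map
  have hιK : ∀ x : K, ι₂.symm (ι'₀ (closureEmb (K := K) L (algebraMap K (AlgebraicClosure K) x))) =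
      algebraMap K (AlgebraicClosure E) x := fun x ↦ by
    rw [AlgHom.commutes, IsScalarTower.algebraMap_apply K L (AlgebraicClosure L), AlgHom.commutes,
      ← IsScalarTower.algebraMap_apply, IsScalarTower.algebraMap_apply K E' (AlgebraicClosure E'),
      ← hfK, ← hf', RingEquiv.symm_apply_apply, ← IsScalarTower.algebraMap_apply]
  let ι : AlgebraicClosure K →ₐ[K] AlgebraicClosure E :=
    { (ι₂.symm : AlgebraicClosure E' →+* AlgebraicClosure E).comp
        (ι'₀.toRingHom.comp (closureEmb (K := K) L).toRingHom) with
      commutes' := fun x ↦ hιK x }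
  have hιapply : ∀ z, ι z = ι₂.symm (ι'₀ (closureEmb (K := K) L z)) := fun _ ↦ rfl
  have hcompat : ∀ z : AlgebraicClosure K, ι'₀ (closureEmb (K := K) L z) = ι₂ (ι z) := fun z ↦ by
    rw [hιapply, RingEquiv.apply_symm_apply]
  have hεL : ∀ l : L, ε (algebraMap L E' l) =
      ι (ιL.symm (algebraMap L (AlgebraicClosure L) l)) := fun l ↦ by
    rw [hιapply, ← algEquivOfEmb_apply L (closureEmb (K := K) L), AlgEquiv.apply_symm_apply,
      AlgHom.commutes, IsScalarTower.algebraMap_apply L E' (AlgebraicClosure E'), hι₂symm]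
  exact ⟨ι, ι₂, hcompat, hf', forall_fix_of_closure_eq_top L ι ι₂ f ε hεf hεL hι₂symm hgen⟩

end Generic


/-! ## §2 Packages at the finite places -/

section Finite

variable {K : Type u} [Field K] [NumberField K] (L : Type u) [Field L] [NumberField L] [Algebra K L]
variable {E : Type u} [Field E] [Algebra K E]
variable (v : HeightOneSpectrum (𝓞 K)) (e : v.adicCompletion K ≃+* E)
  (he : ∀ x : K, e (algebraMap K (v.adicCompletion K) x) = algebraMap K E x)

include he in
/-- **Package at a finite place, from a `K`-embedding.** For a model `e : K_v ≃ E` of the completion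
at `v` and ANY `K`-embedding `ι : K̄ → Ē` (`L/K` Galois): there are a place `w ∣ v` of `L`,
`ι₂ : Ē ≃ L̄_w` and an `L`-embedding `ι' : L̄ → L̄_w` with `ι' ∘ ι_L = ι₂ ∘ ι`, `ι₂|_E = (K_v → L_w) ∘ e⁻¹`
and the fixing hypothesis — `ι|_L` factors through some `L_w` (`exists_place_factorisation`) and
`L_w = K_v·L` (`closure_range_adicCompletionMap_union_eq_top`).
[cite: NeukirchANT1999, II.§8] [cite: SerreGaloisCohomology1997, II.§1.1] -/
theorem exists_package_adicCompletion [IsGalois K L]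
    (ι : AlgebraicClosure K →ₐ[K] AlgebraicClosure E) :
    ∃ (w : HeightOneSpectrum (𝓞 L)) (_ : w.asIdeal.LiesOver v.asIdeal)
      (ι₂ : AlgebraicClosure E ≃+* AlgebraicClosure (w.adicCompletion L))
      (ι' : AlgebraicClosure L →ₐ[L] AlgebraicClosure (w.adicCompletion L)),
      (∀ z : AlgebraicClosure K, ι' (closureEmb (K := K) L z) = ι₂ (ι z)) ∧
      (∀ y : E, ι₂ (algebraMap E (AlgebraicClosure E) y) =
        algebraMap (w.adicCompletion L) (AlgebraicClosure (w.adicCompletion L))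
          (adicCompletionMap (K := K) L v w (e.symm y))) ∧
      (∀ h : Field.absoluteGaloisGroup E, resGalOfEmb ι h ∈ galRange (K := K) L →
        ∀ y : w.adicCompletion L,
        (show AlgebraicClosure E ≃ₐ[E] AlgebraicClosure E from h)
            (ι₂.symm (algebraMap (w.adicCompletion L) (AlgebraicClosure (w.adicCompletion L)) y)) =
          ι₂.symm (algebraMap (w.adicCompletion L) (AlgebraicClosure (w.adicCompletion L)) y)) := by
  let ιL : AlgebraicClosure K ≃ₐ[K] AlgebraicClosure L := algEquivOfEmb L (closureEmb (K := K) L)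
  let φ : L →+* AlgebraicClosure E :=
    ι.toRingHom.comp ((ιL.symm : AlgebraicClosure L →+* AlgebraicClosure K).comp
      (algebraMap L (AlgebraicClosure L)))
  have hφapply : ∀ l, φ l = ι (ιL.symm (algebraMap L (AlgebraicClosure L) l)) := fun _ ↦ rfl
  let ιv : v.adicCompletion K →+* AlgebraicClosure E :=
    (algebraMap E (AlgebraicClosure E)).comp e.toRingHom
  have hιv : ∀ a, ιv a = algebraMap E (AlgebraicClosure E) (e a) := fun _ ↦ rfl
  have hφ : φ.comp (algebraMap K L) = ιv.comp (algebraMap K (v.adicCompletion K)) := by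
    ext x
    change φ (algebraMap K L x) = ιv (algebraMap K (v.adicCompletion K) x)
    rw [hφapply, hιv, he, ← IsScalarTower.algebraMap_apply K L (AlgebraicClosure L),
      AlgEquiv.commutes, AlgHom.commutes, ← IsScalarTower.algebraMap_apply]
  obtain ⟨w, hw, ε, hεv, hεφ⟩ := exists_place_factorisation L v ιv φ hφ
  let f : E →+* w.adicCompletion L := (adicCompletionMap (K := K) L v w).comp e.symm.toRingHom
  have hfapply : ∀ y, f y = adicCompletionMap (K := K) L v w (e.symm y) := fun _ ↦ rfl
  have hεf : ε.comp f = algebraMap E (AlgebraicClosure E) := by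
    ext y
    change ε (adicCompletionMap (K := K) L v w (e.symm y)) = _
    rw [← RingHom.comp_apply, hεv, hιv, RingEquiv.apply_symm_apply]
  have hrange : Set.range f = Set.range (adicCompletionMap (K := K) L v w) := by
    ext z
    constructor
    · rintro ⟨y, rfl⟩; exact ⟨e.symm y, rfl⟩
    · rintro ⟨a, rfl⟩; exact ⟨e a, by rw [hfapply, RingEquiv.symm_apply_apply]⟩
  have hgen : Subring.closure (Set.range f ∪ Set.range (algebraMap L (w.adicCompletion L))) = ⊤ := by
    rw [hrange]; exact closure_range_adicCompletionMap_union_eq_top L v w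
  obtain ⟨ι₂, ι', hcompat, hf, hfixL⟩ := exists_package_of_factorisation L ι f ε hεf
    (fun l ↦ (RingHom.congr_fun hεφ l).trans (hφapply l)) hgen
  exact ⟨w, hw, ι₂, ι', hcompat, fun y ↦ (hf y).trans (by rw [hfapply]), hfixL⟩

include he in
/-- **Package at a finite place, from an `L`-embedding.** For `w ∣ v`, a model `e : K_v ≃ E` and ANY
`L`-embedding `ι'₀ : L̄ → L̄_w`: there are a `K`-embedding `ι : K̄ → Ē` and `ι₂ : Ē ≃ L̄_w` with
`ι'₀ ∘ ι_L = ι₂ ∘ ι`, `ι₂|_E = (K_v → L_w) ∘ e⁻¹` and the fixing hypothesis (`Ē` is an algebraic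
closure of `L_w` through a `K_v`-embedding `L_w → Ē`, `exists_ringHom_adicCompletion`).
[cite: NeukirchANT1999, II.§8] [cite: SerreGaloisCohomology1997, II.§1.1] -/
theorem exists_package_adicCompletion_of_embedding (w : HeightOneSpectrum (𝓞 L))
    [w.asIdeal.LiesOver v.asIdeal]
    (ι'₀ : AlgebraicClosure L →ₐ[L] AlgebraicClosure (w.adicCompletion L)) :
    ∃ (ι : AlgebraicClosure K →ₐ[K] AlgebraicClosure E)
      (ι₂ : AlgebraicClosure E ≃+* AlgebraicClosure (w.adicCompletion L)),
      (∀ z : AlgebraicClosure K, ι'₀ (closureEmb (K := K) L z) = ι₂ (ι z)) ∧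
      (∀ y : E, ι₂ (algebraMap E (AlgebraicClosure E) y) =
        algebraMap (w.adicCompletion L) (AlgebraicClosure (w.adicCompletion L))
          (adicCompletionMap (K := K) L v w (e.symm y))) ∧
      (∀ h : Field.absoluteGaloisGroup E, resGalOfEmb ι h ∈ galRange (K := K) L →
        ∀ y : w.adicCompletion L,
        (show AlgebraicClosure E ≃ₐ[E] AlgebraicClosure E from h)
            (ι₂.symm (algebraMap (w.adicCompletion L) (AlgebraicClosure (w.adicCompletion L)) y)) =
          ι₂.symm (algebraMap (w.adicCompletion L) (AlgebraicClosure (w.adicCompletion L)) y)) := by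
  let ιv : v.adicCompletion K →+* AlgebraicClosure E :=
    (algebraMap E (AlgebraicClosure E)).comp e.toRingHom
  have hιv : ∀ a, ιv a = algebraMap E (AlgebraicClosure E) (e a) := fun _ ↦ rfl
  obtain ⟨ε, hεv⟩ := exists_ringHom_adicCompletion L v w ιv
  let f : E →+* w.adicCompletion L := (adicCompletionMap (K := K) L v w).comp e.symm.toRingHom
  have hfapply : ∀ y, f y = adicCompletionMap (K := K) L v w (e.symm y) := fun _ ↦ rfl
  have hεf : ε.comp f = algebraMap E (AlgebraicClosure E) := by
    ext y
    change ε (adicCompletionMap (K := K) L v w (e.symm y)) = _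
    rw [← RingHom.comp_apply, hεv, hιv, RingEquiv.apply_symm_apply]
  have hesymm : ∀ x : K, e.symm (algebraMap K E x) = algebraMap K (v.adicCompletion K) x :=
    fun x ↦ by rw [← he, RingEquiv.symm_apply_apply]
  have hfK : ∀ x : K, f (algebraMap K E x) = algebraMap K (w.adicCompletion L) x := fun x ↦ by
    rw [hfapply, hesymm]
    change adicCompletionMap (K := K) L v w (x : v.adicCompletion K) = _
    rw [adicCompletionMap_coe, IsScalarTower.algebraMap_apply K L (w.adicCompletion L)]
    rfl
  have hrange : Set.range f = Set.range (adicCompletionMap (K := K) L v w) := by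
    ext z
    constructor
    · rintro ⟨y, rfl⟩; exact ⟨e.symm y, rfl⟩
    · rintro ⟨a, rfl⟩; exact ⟨e a, by rw [hfapply, RingEquiv.symm_apply_apply]⟩
  have hgen : Subring.closure (Set.range f ∪ Set.range (algebraMap L (w.adicCompletion L))) = ⊤ := by
    rw [hrange]; exact closure_range_adicCompletionMap_union_eq_top L v w
  obtain ⟨ι, ι₂, hcompat, hf, hfixL⟩ := exists_package_of_embedding L ι'₀ f hfK ε hεf hgen
  exact ⟨ι, ι₂, hcompat, fun y ↦ (hf y).trans (by rw [hfapply]), hfixL⟩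

end Finite

/-! ## §3 Packages at the infinite places -/

section Infinite

open scoped NumberField.LiesOver

variable {K : Type u} [Field K] [NumberField K] (L : Type u) [Field L] [NumberField L] [Algebra K L]
variable (v : InfinitePlace K)

omit [NumberField K] [NumberField L] in
/-- **Package at an infinite place, from a `K`-embedding** (`E = K_v`): as in §2 with
`exists_infinitePlace_factorisation` and `closure_range_completionMap_union_eq_top`.
[cite: NeukirchANT1999, II.§8] [cite: SerreGaloisCohomology1997, II.§1.1] -/
theorem exists_package_infinitePlace [IsGalois K L]
    (ι : AlgebraicClosure K →ₐ[K] AlgebraicClosure v.Completion) :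
    ∃ (w : InfinitePlace L) (_ : w.1.LiesOver v.1)
      (ι₂ : AlgebraicClosure v.Completion ≃+* AlgebraicClosure w.Completion)
      (ι' : AlgebraicClosure L →ₐ[L] AlgebraicClosure w.Completion),
      (∀ z : AlgebraicClosure K, ι' (closureEmb (K := K) L z) = ι₂ (ι z)) ∧
      (∀ y : v.Completion, ι₂ (algebraMap v.Completion (AlgebraicClosure v.Completion) y) =
        algebraMap w.Completion (AlgebraicClosure w.Completion)
          (LiesOver.completionMap (v := v) (w := w) y)) ∧
      (∀ h : Field.absoluteGaloisGroup v.Completion, resGalOfEmb ι h ∈ galRange (K := K) L →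
        ∀ y : w.Completion,
        (show AlgebraicClosure v.Completion ≃ₐ[v.Completion] AlgebraicClosure v.Completion from h)
            (ι₂.symm (algebraMap w.Completion (AlgebraicClosure w.Completion) y)) =
          ι₂.symm (algebraMap w.Completion (AlgebraicClosure w.Completion) y)) := by
  let ιL : AlgebraicClosure K ≃ₐ[K] AlgebraicClosure L := algEquivOfEmb L (closureEmb (K := K) L)
  let φ : L →+* AlgebraicClosure v.Completion :=
    ι.toRingHom.comp ((ιL.symm : AlgebraicClosure L →+* AlgebraicClosure K).comp
      (algebraMap L (AlgebraicClosure L)))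
  have hφapply : ∀ l, φ l = ι (ιL.symm (algebraMap L (AlgebraicClosure L) l)) := fun _ ↦ rfl
  have hφ : φ.comp (algebraMap K L) =
      (algebraMap v.Completion (AlgebraicClosure v.Completion)).comp (algebraMap K v.Completion) := by
    ext x
    change φ (algebraMap K L x) = algebraMap v.Completion _ (algebraMap K v.Completion x)
    rw [hφapply, ← IsScalarTower.algebraMap_apply K L (AlgebraicClosure L), AlgEquiv.commutes,
      AlgHom.commutes, ← IsScalarTower.algebraMap_apply]
  obtain ⟨w, hw, ε, hεv, hεφ⟩ := exists_infinitePlace_factorisation L v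
    (algebraMap v.Completion (AlgebraicClosure v.Completion)) φ hφ
  haveI : IsScalarTower K L w.Completion := isScalarTower_completion L w
  obtain ⟨ι₂, ι', hcompat, hf, hfixL⟩ := exists_package_of_factorisation L ι
    (LiesOver.completionMap (v := v) (w := w)) ε hεv
    (fun l ↦ (RingHom.congr_fun hεφ l).trans (hφapply l))
    (closure_range_completionMap_union_eq_top L v w)
  exact ⟨w, hw, ι₂, ι', hcompat, hf, hfixL⟩

/-- **Package at an infinite place, from an `L`-embedding** (`E = K_v`, `w ∣ v`).
[cite: NeukirchANT1999, II.§8] [cite: SerreGaloisCohomology1997, II.§1.1] -/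
theorem exists_package_infinitePlace_of_embedding (w : InfinitePlace L) [w.1.LiesOver v.1]
    (ι'₀ : AlgebraicClosure L →ₐ[L] AlgebraicClosure w.Completion) :
    ∃ (ι : AlgebraicClosure K →ₐ[K] AlgebraicClosure v.Completion)
      (ι₂ : AlgebraicClosure v.Completion ≃+* AlgebraicClosure w.Completion),
      (∀ z : AlgebraicClosure K, ι'₀ (closureEmb (K := K) L z) = ι₂ (ι z)) ∧
      (∀ y : v.Completion, ι₂ (algebraMap v.Completion (AlgebraicClosure v.Completion) y) =
        algebraMap w.Completion (AlgebraicClosure w.Completion)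
          (LiesOver.completionMap (v := v) (w := w) y)) ∧
      (∀ h : Field.absoluteGaloisGroup v.Completion, resGalOfEmb ι h ∈ galRange (K := K) L →
        ∀ y : w.Completion,
        (show AlgebraicClosure v.Completion ≃ₐ[v.Completion] AlgebraicClosure v.Completion from h)
            (ι₂.symm (algebraMap w.Completion (AlgebraicClosure w.Completion) y)) =
          ι₂.symm (algebraMap w.Completion (AlgebraicClosure w.Completion) y)) := by
  haveI : IsScalarTower K L w.Completion := isScalarTower_completion L w
  obtain ⟨ε, hεv⟩ := exists_ringHom_infCompletion L v w
    (algebraMap v.Completion (AlgebraicClosure v.Completion))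
  have hfK : ∀ x : K, LiesOver.completionMap (v := v) (w := w) (algebraMap K v.Completion x) =
      algebraMap K w.Completion x := fun x ↦ by
    rw [← RingHom.algebraMap_toAlgebra (LiesOver.completionMap (v := v) (w := w)),
      ← IsScalarTower.algebraMap_apply]
  exact exists_package_of_embedding L ι'₀ (LiesOver.completionMap (v := v) (w := w)) hfK ε hεv
    (closure_range_completionMap_union_eq_top L v w)

end Infinite

end Summit.BirchSwinnertonDyer.BirchSwinnertonDyer.Theorems.EtaLayer

end
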